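import Summits.Schanuel.Schanuel.Theorems.RootDecomp1KXAll01

/-!
# RootDecomp1KXAll — lens 1, generation 46, node 5 «ALL CURVES: ThinFibreAt m₀ P for EVERY P ∈ ℤ[x][Y], P ≠ 0, at every m₀ ≥ thinThreshold P = max(3, 2·μ(P)+1, e(P)+1)» (CLAIM L2336, PRICE + CHECKLIST K-g46 L2337, NODE L2353, critic VERDICT L2357: CLEARED THEOREM ×1 under K-R35 — the last threshold-THEOREM of the K-line, UNCONDITIONAL; PORT GO L2357) — continuation (RootDecomp1KXAll02): §XIV.3 dichotomy with multiplicity, §XIV.4 its arithmetic end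

(lens-1 g46 HOME kernel K₅ = HOME/decomp-schanuel-lens-1/g46/XAll.lean 4f432885…, 1310 l, ONE import …RootDecomp1KXTop03; P₅/C₅ + NODE-g46.md. Port by census-1 gen 20 as `RootDecomp1KXAll01–06` (the memo's 01–05 split with §XIV.8 cut in two by the 400-line cap): 01 = private helper copies + §XIV.1 roots with multiplicity in `ℂ₂` and the nearest-root lemma without separability (`roots_data_mult`, `nearest_root_mult`, `rootMultiplicity_le_one_of_separable`, `rootMultiplicity_le_natDegree'`) + §XIV.2 Ridout for rationals with exponent `κ = a/b > 2` (`ridout_one_pow`, `ridout_window_pow`; tree `Ridout.finite_of_abs_le_one` BY NAME, called once); 02 = §XIV.3 the dichotomy with multiplicity (`near_root_or_at_infinity_mult`) + §XIV.4 its arithmetic end (`dichotomy_arith_mult`); 03 = §XIV.5 THE PARAMETRIC THEOREM `thinFibreAt_xPoly_mult` (+ `_claim`, `_again` private, `_crude`) + §XIV.6 every `P ∈ ℤ[x][Y]` (`xCoeff`, `topX`, `eTop`, `muTop`, `thinThreshold`, `xPolyP_xCoeff`, **`thinFibreAt_all`**, `thinFibreAt_effective`); 04 = §XIV.7 CONSUMER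 for all x-degrees (`xCoeff_dX`, …, `thinThreshold_dX_le`, `no_relation_of_closed_class`, `allCurves_nonvanishing`); 05 = §XIV.8 thresholds of `xPolyP k c` in the data `(μ, e)`, specialisations BY NAME (examples against tree `…XTop.thinFibreAt_xPoly`, `…XLinearII.thinFibreAt_xLinear_sep`, `ridout_window`, `dichotomy_arith`), root-multiplicity bounds, the P₃-family `thinFibreAt_purePowerTop`; 06 = members P₁ P₂ P₃ with thresholds 5 / 7 / 5 proved as theorems + CONSUMER at the members.
PORT EDITS (sanctioned in VERDICT L2357 (a)–(e)): `set_option linter.dupNamespace false` dropped; `thinFibreAt_xPoly_again` and `thinFibreAt_xLinear_sep_again` (type-twins of tree `…XTop.thinFibreAt_xPoly` / `…XLinearII.thinFibreAt_xLinear_sep`) made `private` (dedup); per-part private helper copies; the two scoped `set_option maxHeartbeats 400000 in` kept as in K₅; `example` blocks kept; 19 one-line docstrings added (gate lint.docstring); statements and proofs otherwise verbatim. `--supports stmt-Schanuel-33364`; no census credit carried; rung 0 — nothing here proves Schanuel; no ∀-item of 1K moves.)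
-/

noncomputable section

namespace Summit.Schanuel.Schanuel.Theorems.RootDecomp1KXAll

open Polynomial LiouvilleNumber
open scoped Nat
open Summit.Schanuel.Schanuel.Theorems.RootDecomp1KSkelCell
  (exists_le_two_pow_factorial iota iota_spec iota_le_of_le pow_lt_of_lt_iota lt_iota_of_pow_lt iota_mono
   one_le_iota SkelLiouville SkelLiouvilleFix skelLiouville_iff_fix SkelLiouvilleFix.mono uStar dU rU dU_cast
   two_pow_le_four_mul_dU two_mul_dU_lt one_le_dU rU_den rU_cast uStar_sub_rU skelLiouvilleFix_one_uStar
   not_skelFixOne_algebraicIndependent)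
open Summit.Schanuel.Schanuel.Theorems.RootDecomp1KTwoBaseCell (psNumer partialSum_eq_psNumer_div coprime_psNumer
  algebraicIndependent_of_forall_int')
open Summit.Schanuel.Schanuel.Theorems.RootDecomp1KRelLiouvilleCell (partialSum_two_strictMono
  partialSum_two_lt_liouvilleNumber abs_liouvilleNumber_two_sub_partialSum)
open Summit.Schanuel.Schanuel.Theorems.RootDecomp1KDegreeLadder
open Summit.Schanuel.Schanuel.Theorems.RootDecomp1KXLinearCore
open Summit.Schanuel.Schanuel.Theorems.RootDecomp1KXLinear
open Summit.Schanuel.Schanuel.Theorems.RootDecomp1KXLinearII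
open Summit.Schanuel.Schanuel.Theorems.RootDecomp1KXTop

/-- `‖(z : \overline{ℚ₂})‖ ≤ 1` for integers. -/
private theorem norm_intCast_le_one' (z : ℤ) : ‖(z : PadicAlgCl 2)‖ ≤ 1 := by
  have h1 : (z : PadicAlgCl 2) = algebraMap ℚ_[2] (PadicAlgCl 2) (z : ℚ_[2]) := (map_intCast _ z).symm
  rw [h1, PadicAlgCl.norm_extends]
  exact Padic.norm_int_le_one z

/-! ## §XIV.3  The dichotomy with multiplicity: near a (possibly multiple) finite point over `x = ∞`, or at `(∞, ∞)` -/

set_option maxHeartbeats 400000 in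
/-- **near a root of `c_k` (with multiplicity), or 2-adically at `(∞, ∞)`**: if every root of `c_k` in `ℂ₂` has
multiplicity `≤ μ`, then for `N ≥ N₁` every rational point `r` of level `N` either has a root `β` of `c_k` with
`‖lc·(r − β)‖₂^μ ≤ cc·2^{−N!}`, or satisfies `‖lc‖₂·2^{N!} ≤ ‖r‖₂^e` with `e ≥ 1`. -/
theorem near_root_or_at_infinity_mult (k : ℕ) (c : ℕ → ℤ[X]) (e μ : ℕ) (hd : 1 ≤ (c k).natDegree)
    (hmult : ∀ β : PadicAlgCl 2, rootMultiplicity β ((c k).map (algebraMap ℤ (PadicAlgCl 2))) ≤ μ)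
    (hdeg : ∀ j, j < k → (c j).natDegree ≤ (c k).natDegree + e) :
    ∃ (T : Finset (PadicAlgCl 2)) (cc : ℝ) (N₁ : ℕ), 0 < cc ∧ (∀ β ∈ T, aeval β (c k) = 0) ∧
      ∀ N, N₁ ≤ N → ∀ r : ℚ, bev (xPolyP k c) (partialSum 2 N) r = 0 →
        (∃ β ∈ T, ‖((c k).leadingCoeff : PadicAlgCl 2) * ((r : PadicAlgCl 2) - β)‖ ^ μ ≤
            cc * (1 / 2 : ℝ) ^ N !) ∨
        (1 ≤ e ∧ ‖((c k).leadingCoeff : PadicAlgCl 2)‖ * 2 ^ N ! ≤ ‖(r : PadicAlgCl 2)‖ ^ e) := by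
  classical
  set B : ℤ[X] := c k with hBdef
  have hB : B ≠ 0 := by rintro h; rw [h] at hd; simp at hd
  obtain ⟨T, n, c₀, hc₀, hroots, hsum, hprod, hnear⟩ := nearest_root_mult B hd μ hmult
  set ℓ : PadicAlgCl 2 := (B.leadingCoeff : PadicAlgCl 2) with hℓdef
  have hℓpos : 0 < ‖ℓ‖ := by rw [norm_pos_iff, hℓdef]; exact_mod_cast leadingCoeff_ne_zero.mpr hB
  have hℓle : ‖ℓ‖ ≤ 1 := norm_intCast_le_one' _
  set R₀ : ℝ := 1 + ∑ β ∈ T, ‖β‖ with hR₀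
  have hR₀1 : 1 ≤ R₀ := by
    have : 0 ≤ ∑ β ∈ T, ‖β‖ := Finset.sum_nonneg fun β _ => norm_nonneg β
    linarith
  have hR₀β : ∀ β ∈ T, ‖β‖ < R₀ := by
    intro β hβ
    have := Finset.single_le_sum (f := fun β => ‖β‖) (fun β _ => norm_nonneg β) hβ
    linarith
  have hR₀pos : 0 < R₀ := lt_of_lt_of_le one_pos hR₀1
  set d : ℕ := B.natDegree with hddef
  set cc : ℝ := c₀ * R₀ ^ (d + e) with hccdef
  have hccpos : 0 < cc := mul_pos hc₀ (pow_pos hR₀pos _)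
  obtain ⟨N₁, hN₁⟩ := exists_pow_lt_of_lt_one hℓpos (show (1 / 2 : ℝ) < 1 by norm_num)
  obtain ⟨N₁', hN₁'⟩ := exists_pow_lt_of_lt_one (one_div_pos.mpr hccpos) (show (1 / 2 : ℝ) < 1 by norm_num)
  refine ⟨T, cc, max (max N₁ N₁') 3, hccpos, hroots, fun N hN r hP => ?_⟩
  have hN3 : 3 ≤ N := le_trans (le_max_right _ _) hN
  have hNN₁ : N₁ ≤ N := le_trans (le_trans (le_max_left _ _) (le_max_left _ _)) hN
  have hNN₁' : N₁' ≤ N := le_trans (le_trans (le_max_right _ _) (le_max_left _ _)) hN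
  have hdom := top_coeff_small k c e hdeg hN3 r hP
  rw [← hBdef] at hdom
  set M : ℝ := max 1 ‖(r : PadicAlgCl 2)‖ with hMdef
  have hM1 : 1 ≤ M := le_max_left _ _
  have h2pos : (0 : ℝ) < 2 ^ N ! := by positivity
  have hhalf : (1 / 2 : ℝ) ^ N ! * 2 ^ N ! = 1 := by
    rw [div_pow, one_pow, div_mul_cancel₀ _ (ne_of_gt h2pos)]
  by_cases hrR : ‖(r : PadicAlgCl 2)‖ ≤ R₀
  · -- near a finite root (with multiplicity)
    left
    have hMR : M ≤ R₀ := max_le hR₀1 hrR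
    have hBle : ‖aeval (r : PadicAlgCl 2) B‖ ≤ (1 / 2 : ℝ) ^ N ! * R₀ ^ (d + e) :=
      hdom.trans (mul_le_mul_of_nonneg_left (pow_le_pow_left₀ (zero_le_one.trans hM1) hMR _) (by positivity))
    obtain ⟨β, hβT, hβ⟩ := hnear (r : PadicAlgCl 2)
    have hsmall : min 1 ‖(r : PadicAlgCl 2) - β‖ ^ μ ≤ cc * (1 / 2 : ℝ) ^ N ! :=
      hβ.trans (by
        calc c₀ * ‖aeval (r : PadicAlgCl 2) B‖ ≤ c₀ * ((1 / 2 : ℝ) ^ N ! * R₀ ^ (d + e)) := by gcongr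
          _ = cc * (1 / 2 : ℝ) ^ N ! := by rw [hccdef]; ring)
    have hlt1 : cc * (1 / 2 : ℝ) ^ N ! < 1 := by
      have h1 : (1 / 2 : ℝ) ^ N ! ≤ (1 / 2 : ℝ) ^ N₁' :=
        pow_le_pow_of_le_one (by norm_num) (by norm_num) (hNN₁'.trans (Nat.self_le_factorial N))
      have h2 : cc * (1 / 2 : ℝ) ^ N ! < cc * (1 / cc) := by
        exact mul_lt_mul_of_pos_left (lt_of_le_of_lt h1 hN₁') hccpos
      rwa [mul_one_div_cancel hccpos.ne'] at h2
    have hrβ : ‖(r : PadicAlgCl 2) - β‖ < 1 := by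
      by_contra hge
      push Not at hge
      rw [min_eq_left hge, one_pow] at hsmall
      linarith
    rw [min_eq_right hrβ.le] at hsmall
    refine ⟨β, hβT, ?_⟩
    rw [norm_mul, mul_pow]
    calc ‖ℓ‖ ^ μ * ‖(r : PadicAlgCl 2) - β‖ ^ μ ≤ 1 * ‖(r : PadicAlgCl 2) - β‖ ^ μ := by
          gcongr; exact pow_le_one₀ (norm_nonneg _) hℓle
      _ ≤ cc * (1 / 2 : ℝ) ^ N ! := by rw [one_mul]; exact hsmall
  · -- far from all finite roots: the top coefficient is large, so `‖r‖^e` must pay for `2^{N!}`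
    right
    push Not at hrR
    have hr1 : 1 ≤ ‖(r : PadicAlgCl 2)‖ := hR₀1.trans hrR.le
    have hrpos : 0 < ‖(r : PadicAlgCl 2)‖ := lt_of_lt_of_le one_pos hr1
    have hfac : ∀ β ∈ T, ‖(r : PadicAlgCl 2) - β‖ ^ n β = ‖(r : PadicAlgCl 2)‖ ^ n β := by
      intro β hβ
      have hne : ‖(r : PadicAlgCl 2)‖ ≠ ‖-β‖ := by
        rw [norm_neg]; exact ne_of_gt ((hR₀β β hβ).trans hrR)
      rw [sub_eq_add_neg, IsUltrametricDist.norm_add_eq_max_of_norm_ne_norm hne, norm_neg,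
        max_eq_left ((hR₀β β hβ).trans hrR).le]
    have hBn : ‖aeval (r : PadicAlgCl 2) B‖ = ‖ℓ‖ * ‖(r : PadicAlgCl 2)‖ ^ d := by
      rw [hprod, norm_mul, norm_prod]
      simp only [norm_pow]
      rw [Finset.prod_congr rfl hfac, Finset.prod_pow_eq_pow_sum, hsum]
    have hMr : M = ‖(r : PadicAlgCl 2)‖ := max_eq_right hr1
    have h1 : ‖ℓ‖ * ‖(r : PadicAlgCl 2)‖ ^ d ≤
        ((1 / 2 : ℝ) ^ N ! * ‖(r : PadicAlgCl 2)‖ ^ e) * ‖(r : PadicAlgCl 2)‖ ^ d := by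
      rw [← hBn, mul_assoc, ← pow_add, add_comm e d, ← hMr]; exact hdom
    have h2 : ‖ℓ‖ ≤ (1 / 2 : ℝ) ^ N ! * ‖(r : PadicAlgCl 2)‖ ^ e := le_of_mul_le_mul_right h1 (pow_pos hrpos _)
    have h3 : ‖ℓ‖ * 2 ^ N ! ≤ ‖(r : PadicAlgCl 2)‖ ^ e := by
      have := mul_le_mul_of_nonneg_right h2 h2pos.le
      calc ‖ℓ‖ * 2 ^ N ! ≤ (1 / 2 : ℝ) ^ N ! * ‖(r : PadicAlgCl 2)‖ ^ e * 2 ^ N ! := this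
        _ = ‖(r : PadicAlgCl 2)‖ ^ e := by rw [mul_comm, ← mul_assoc, mul_comm (2 ^ N ! : ℝ), hhalf, one_mul]
    refine ⟨?_, h3⟩
    by_contra he
    have he0 : e = 0 := by omega
    rw [he0, pow_zero] at h2
    have h4 : (1 / 2 : ℝ) ^ N ! ≤ (1 / 2 : ℝ) ^ N₁ :=
      pow_le_pow_of_le_one (by norm_num) (by norm_num) (hNN₁.trans (Nat.self_le_factorial N))
    linarith

/-! ## §XIV.4  The arithmetic end of the dichotomy with multiplicity `μ` -/

/-- **`dichotomy_arith_mult`**: if the root distance `x` of a point satisfies `x^μ ≤ c·2^{−N!}` but the Ridout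
inequality `den^{4μ+1}·x^{2μ} ≤ 1` FAILS, the denominator wins for `N ≥ N₂(μ, c, C)`: `C·2^{(N+1)!} < den^{(2μ+1)N}`.
(`W = 2^{N!}`: `W² < c²·den^{4μ+1}`; if `den^{(2μ+1)N} ≤ C·W^{N+1}` then `W^{2(2μ+1)N} < c^{2(2μ+1)N}·C^{4μ+1}·W^{(4μ+1)(N+1)}`,
i.e. `W^{N−4μ−1} < c^{2(2μ+1)N}·C^{4μ+1} ≤ G^{N+1} ≤ W^{N−4μ−2}` — absurd.  `μ = 1` is the tree's `dichotomy_arith`.) -/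
theorem dichotomy_arith_mult (μ : ℕ) (c C : ℝ) : ∃ N₂ : ℕ, ∀ N, N₂ ≤ N → ∀ (d : ℕ) (x : ℝ), 1 ≤ d → 0 ≤ x →
    x ^ μ ≤ c * (1 / 2 : ℝ) ^ N ! → ¬ ((d : ℝ) ^ (4 * μ + 1) * x ^ (2 * μ) ≤ 1) →
    C * 2 ^ (N + 1)! < (d : ℝ) ^ ((2 * μ + 1) * N) := by
  set A : ℕ := 4 * μ + 1 with hA
  set M : ℕ := 2 * μ + 1 with hM
  set G : ℝ := max 1 (max (C ^ A) (c ^ (2 * M))) with hG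
  obtain ⟨N₂, hN₂⟩ := eventually_pow_le' G (A + 1)
  refine ⟨max N₂ (A + 1), fun N hN d x hd hx0 hx hnot => ?_⟩
  push Not at hnot
  have hNN₂ : N₂ ≤ N := le_trans (le_max_left _ _) hN
  have hNA : A + 1 ≤ N := le_trans (le_max_right _ _) hN
  have hdR : (1 : ℝ) ≤ d := by exact_mod_cast hd
  have hdpow : 0 < (d : ℝ) ^ (M * N) := by positivity
  rcases le_or_gt C 0 with hC | hC
  · have : C * 2 ^ (N + 1)! ≤ 0 := mul_nonpos_iff.mpr (Or.inr ⟨hC, by positivity⟩)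
    linarith
  set W : ℝ := (2 : ℝ) ^ N ! with hW
  have hWpos : 0 < W := by positivity
  have hW1 : 1 < W := by rw [hW]; exact one_lt_pow₀ (by norm_num) (Nat.factorial_pos N).ne'
  have hhalf : (1 / 2 : ℝ) ^ N ! = W⁻¹ := by rw [hW, one_div_pow, one_div]
  -- `W² < c² d^A`
  have hx2 : x ^ (2 * μ) ≤ c ^ 2 * W⁻¹ ^ 2 := by
    rw [← mul_pow, ← hhalf, mul_comm 2 μ, pow_mul]
    exact pow_le_pow_left₀ (pow_nonneg hx0 μ) hx 2
  have hW2 : W ^ 2 < c ^ 2 * (d : ℝ) ^ A := by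
    have h1 : 1 < (d : ℝ) ^ A * (c ^ 2 * W⁻¹ ^ 2) := lt_of_lt_of_le hnot (by gcongr)
    rw [inv_pow, ← div_eq_mul_inv, ← mul_div_assoc, lt_div_iff₀ (by positivity), one_mul] at h1
    linarith
  have hfac : (2 : ℝ) ^ (N + 1)! = W ^ (N + 1) := by
    rw [hW, ← pow_mul, Nat.factorial_succ, mul_comm]
  rw [hfac]
  by_contra hge
  push Not at hge
  have h5 : ((d : ℝ) ^ (M * N)) ^ A ≤ (C * W ^ (N + 1)) ^ A := pow_le_pow_left₀ hdpow.le hge A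
  have hMN : M * N ≠ 0 := mul_ne_zero (by omega) (by omega)
  have h6 : (W ^ 2) ^ (M * N) < (c ^ 2 * (d : ℝ) ^ A) ^ (M * N) :=
    pow_lt_pow_left₀ hW2 (by positivity) hMN
  have h7 : (c ^ 2 * (d : ℝ) ^ A) ^ (M * N) = c ^ (2 * (M * N)) * ((d : ℝ) ^ (M * N)) ^ A := by
    rw [mul_pow, ← pow_mul, ← pow_mul, ← pow_mul, mul_comm A (M * N)]
  obtain ⟨t, rfl⟩ : ∃ t, N = t + A := ⟨N - A, by omega⟩
  have hexp : 2 * (M * (t + A)) = t + A * (t + A + 1) := by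
    simp only [hM, hA]; ring
  have h8 : (W ^ 2) ^ (M * (t + A)) = W ^ t * W ^ (A * (t + A + 1)) := by
    rw [← pow_mul, ← pow_add, hexp]
  have h9 : (C * W ^ (t + A + 1)) ^ A = C ^ A * W ^ (A * (t + A + 1)) := by
    rw [mul_pow, ← pow_mul, mul_comm (t + A + 1) A]
  rw [h7] at h6
  rw [h9] at h5
  have hc6 : 0 ≤ c ^ (2 * (M * (t + A))) := by rw [pow_mul]; positivity
  have h10 : W ^ t * W ^ (A * (t + A + 1)) <
      (c ^ (2 * (M * (t + A))) * C ^ A) * W ^ (A * (t + A + 1)) := by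
    rw [← h8, mul_assoc]; exact h6.trans_le (mul_le_mul_of_nonneg_left h5 hc6)
  have hp : 0 < W ^ (A * (t + A + 1)) := by positivity
  have h11 : W ^ t < c ^ (2 * (M * (t + A))) * C ^ A := lt_of_mul_lt_mul_right h10 hp.le
  -- but `c^{2MN} C^A ≤ G^{N+1} ≤ 2^{(N−A−1) N!} = W^{t−1} < W^t`
  have hG1 : 1 ≤ G := le_max_left _ _
  have hcG : c ^ (2 * (M * (t + A))) ≤ G ^ (t + A) := by
    rw [show 2 * (M * (t + A)) = (2 * M) * (t + A) by ring, pow_mul]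
    exact pow_le_pow_left₀ (by rw [pow_mul]; positivity) ((le_max_right _ _).trans (le_max_right _ _)) _
  have hCG : C ^ A ≤ G := (le_max_left _ _).trans (le_max_right _ _)
  have h12 : c ^ (2 * (M * (t + A))) * C ^ A ≤ G ^ (t + A + 1) := by
    rw [pow_succ]
    exact mul_le_mul hcG hCG (pow_nonneg hC.le A) (pow_nonneg (zero_le_one.trans hG1) _)
  have h13 : (2 : ℝ) ^ ((t + A - (A + 1)) * (t + A)!) = W ^ (t - 1) := by
    rw [hW, ← pow_mul, show t + A - (A + 1) = t - 1 by omega, mul_comm]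
  have h14 : W ^ (t - 1) < W ^ t := pow_lt_pow_right₀ hW1 (by omega)
  have hGN := hN₂ (t + A) hNN₂
  rw [h13] at hGN
  linarith

end Summit.Schanuel.Schanuel.Theorems.RootDecomp1KXAll

end
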